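import Literature.AlgebraicGeometry.Motives.WeilTypeSignature
import HarnessLib

/-!
# `X⁺` is path connected: the angular-operator parametrisation is continuous

Deligne (LNM 900, proof of Thm. 4.8, p. 49): the domain `X⁺` of `E`-compatible positive `K`-linear
complex structures is "an open CONNECTED complex submanifold of a product of Grassmannians"; van
Geemen (LNM 1594, 5.8–5.10): `H_n ≅ SU(n, n)/S(U(n) × U(n))`. Here this is made precise for the
standard Hermitian space `(ℂᵖ × ℂ^q, H₀ = ⟪·,·⟫ ⊖ ⟪·,·⟫)` of `Motives/UnitaryPeriodDomain` and
`Motives/WeilTypeSignature`: the bijection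
`stdWeilComplexStructureEquiv : X⁺(H₀) ≃ unitaryPeriodDomain p q = {Z : ℂᵖ →L ℂ^q, ‖Z‖ < 1}` is
realised by an EXPLICIT continuous map `Z ↦ J_Z ∈ End(ℂᵖ × ℂ^q)`, so that `X⁺(H₀)`, viewed inside
the normed algebra of bounded operators, is the continuous image of a convex set and hence PATH
CONNECTED (`isPathConnected_stdWeilDomain`).

The formula (Gohberg–Lancaster–Rodman §10.1, "angular operator"; the projection onto a graph
subspace): for `‖Z‖ < 1` the `H₀`-orthogonal complement of the graph `W_Z = {(v, Zv)}` is
`{(Z^* w, w)}` (`Z^*` the Hilbert adjoint), the `H₀`-orthogonal projection onto `W_Z` is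
`P_Z (x₁, x₂) = (v, Z v)`, `v = (1 - Z^* Z)⁻¹ (x₁ - Z^* x₂)` (`1 - Z^* Z` is invertible since
`‖Z^* Z‖ ≤ ‖Z‖² < 1`, Neumann series), and van Geemen's complex structure `J_{W_Z} = i` on `W_Z`,
`-i` on `W_Z^⊥` (`Motives/WeilTypeComplexStructures.complexStructureOfPlane`) is
`J_Z = i (2 P_Z - 1)` (`stdJOp_eq_complexStructureOfPlane`). All ingredients (`Z ↦ Z^*`, products,
`Ring.inverse` at units) are continuous, so `Z ↦ J_Z` is continuous on the domain
(`continuousOn_stdJOp`), and its image is exactly `X⁺(H₀)` (`stdJOp_image`).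

Everything is proved; no named fact is introduced. Not here: the inverse `J ↦ Z` is also continuous
(so `Z ↦ J_Z` is a homeomorphism onto `X⁺`), the complex structure of `X⁺`, framed spaces.

## References

* [Deligne1982HodgeCycles] P. Deligne, LNM 900, proof of Thm. 4.8, p. 49 ("open connected").
* [vanGeemen1994HodgeAV] B. van Geemen, LNM 1594, 5.5–5.10.
* [GohbergLancasterRodman2005] I. Gohberg, P. Lancaster, L. Rodman, *Indefinite Linear Algebra and
  Applications* (2005), §10.1 (graph subspaces, Lemma 10.1.2, Cor. 10.1.4).
* [CarlsonMullerStachPeters2017] J. Carlson, S. Müller-Stach, C. Peters, *Period Mappings and Period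
  Domains*, 2nd ed., Thm. 16.1.5 (type AIII).
-/

noncomputable section

open Module
open scoped ComplexConjugate InnerProductSpace

namespace Literature.AlgebraicGeometry.Motives

variable {p q : ℕ}

/-! ### The operators `1 - Z^* Z`, `P_Z`, `J_Z` -/

/-- `G_Z = 1 - Z^* Z ∈ End(ℂᵖ)` (the Gram operator of the graph of `Z` for `H₀`).
[cite: GohbergLancasterRodman2005, §10.1 (10.1.5)] -/
def stdGramOp (Z : EuclideanSpace ℂ (Fin p) →L[ℂ] EuclideanSpace ℂ (Fin q)) :
    EuclideanSpace ℂ (Fin p) →L[ℂ] EuclideanSpace ℂ (Fin p) :=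
  1 - (ContinuousLinearMap.adjoint Z).comp Z

/-- `‖Z^* Z‖ ≤ ‖Z‖²`. [folklore] -/
theorem norm_adjoint_comp_le (Z : EuclideanSpace ℂ (Fin p) →L[ℂ] EuclideanSpace ℂ (Fin q)) :
    ‖(ContinuousLinearMap.adjoint Z).comp Z‖ ≤ ‖Z‖ * ‖Z‖ := by
  calc ‖(ContinuousLinearMap.adjoint Z).comp Z‖ ≤ ‖ContinuousLinearMap.adjoint Z‖ * ‖Z‖ :=
        ContinuousLinearMap.opNorm_comp_le _ _
    _ = ‖Z‖ * ‖Z‖ := by rw [LinearIsometryEquiv.norm_map]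

/-- For `‖Z‖ < 1`, `‖Z^* Z‖ < 1`. [folklore] -/
theorem norm_adjoint_comp_lt_one {Z : EuclideanSpace ℂ (Fin p) →L[ℂ] EuclideanSpace ℂ (Fin q)}
    (hZ : Z ∈ unitaryPeriodDomain p q) : ‖(ContinuousLinearMap.adjoint Z).comp Z‖ < 1 := by
  rw [unitaryPeriodDomain_eq_ball, Metric.mem_ball, dist_zero_right] at hZ
  calc ‖(ContinuousLinearMap.adjoint Z).comp Z‖ ≤ ‖Z‖ * ‖Z‖ := norm_adjoint_comp_le Z
    _ < 1 := mul_lt_one_of_nonneg_of_lt_one_left (norm_nonneg _) hZ (hZ.le)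

/-- **`1 - Z^* Z` is invertible on the domain** (Neumann series). [cite: GohbergLancasterRodman2005, §10.1] -/
theorem isUnit_stdGramOp {Z : EuclideanSpace ℂ (Fin p) →L[ℂ] EuclideanSpace ℂ (Fin q)}
    (hZ : Z ∈ unitaryPeriodDomain p q) : IsUnit (stdGramOp Z) := by
  have h := (Units.oneSub _ (norm_adjoint_comp_lt_one hZ)).isUnit
  rwa [Units.val_oneSub] at h

/-- The **angular-operator projection** `P_Z (x₁, x₂) = (v, Z v)`, `v = (1 - Z^*Z)⁻¹ (x₁ - Z^* x₂)`:
for `‖Z‖ < 1` the `H₀`-orthogonal projection onto the graph of `Z` (`Ring.inverse` is used, so the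
definition makes sense for every `Z`). [cite: GohbergLancasterRodman2005, §10.1] -/
def stdProjOp (Z : EuclideanSpace ℂ (Fin p) →L[ℂ] EuclideanSpace ℂ (Fin q)) :
    (EuclideanSpace ℂ (Fin p) × EuclideanSpace ℂ (Fin q)) →L[ℂ]
      (EuclideanSpace ℂ (Fin p) × EuclideanSpace ℂ (Fin q)) :=
  ((ContinuousLinearMap.id ℂ _).prod Z).comp
    ((Ring.inverse (stdGramOp Z)).comp
      (ContinuousLinearMap.fst ℂ _ _ - (ContinuousLinearMap.adjoint Z).comp (ContinuousLinearMap.snd ℂ _ _)))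

/-- The **angular-operator complex structure** `J_Z = i (2 P_Z - 1)`.
[cite: vanGeemen1994HodgeAV, 5.5] [cite: GohbergLancasterRodman2005, §10.1] -/
def stdJOp (Z : EuclideanSpace ℂ (Fin p) →L[ℂ] EuclideanSpace ℂ (Fin q)) :
    (EuclideanSpace ℂ (Fin p) × EuclideanSpace ℂ (Fin q)) →L[ℂ]
      (EuclideanSpace ℂ (Fin p) × EuclideanSpace ℂ (Fin q)) :=
  Complex.I • ((2 : ℂ) • stdProjOp Z - 1)

/-- `P_Z x = (v, Z v)` with `v = (1 - Z^*Z)⁻¹ (x₁ - Z^* x₂)`. [cite: GohbergLancasterRodman2005, §10.1] -/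
theorem stdProjOp_apply (Z : EuclideanSpace ℂ (Fin p) →L[ℂ] EuclideanSpace ℂ (Fin q))
    (x : EuclideanSpace ℂ (Fin p) × EuclideanSpace ℂ (Fin q)) :
    stdProjOp Z x =
      (Ring.inverse (stdGramOp Z) (x.1 - ContinuousLinearMap.adjoint Z x.2),
        Z (Ring.inverse (stdGramOp Z) (x.1 - ContinuousLinearMap.adjoint Z x.2))) :=
  rfl

/-- `J_Z x = i (2 P_Z x - x)`. [cite: vanGeemen1994HodgeAV, 5.5] -/
theorem stdJOp_apply (Z : EuclideanSpace ℂ (Fin p) →L[ℂ] EuclideanSpace ℂ (Fin q))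
    (x : EuclideanSpace ℂ (Fin p) × EuclideanSpace ℂ (Fin q)) :
    stdJOp Z x = Complex.I • ((2 : ℂ) • stdProjOp Z x - x) :=
  rfl

/-! ### Continuity -/

/-- `Z ↦ 1 - Z^* Z` is continuous. [folklore] -/
theorem continuous_stdGramOp :
    Continuous (stdGramOp : (EuclideanSpace ℂ (Fin p) →L[ℂ] EuclideanSpace ℂ (Fin q)) → _) :=
  continuous_const.sub
    ((ContinuousLinearMap.adjoint.continuous).clm_comp continuous_id)

/-- `Z ↦ (1 - Z^*Z)⁻¹` is continuous on the domain. [folklore] -/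
theorem continuousOn_inverse_stdGramOp :
    ContinuousOn (fun Z : EuclideanSpace ℂ (Fin p) →L[ℂ] EuclideanSpace ℂ (Fin q) =>
      Ring.inverse (stdGramOp Z)) (unitaryPeriodDomain p q) := by
  intro Z hZ
  obtain ⟨u, hu⟩ := isUnit_stdGramOp hZ
  have h1 : ContinuousAt Ring.inverse (stdGramOp Z) := hu ▸ NormedRing.inverse_continuousAt u
  exact (h1.comp continuous_stdGramOp.continuousAt).continuousWithinAt

/-- **`Z ↦ P_Z` is continuous on the domain.** [cite: GohbergLancasterRodman2005, §10.1] -/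
theorem continuousOn_stdProjOp :
    ContinuousOn (stdProjOp : (EuclideanSpace ℂ (Fin p) →L[ℂ] EuclideanSpace ℂ (Fin q)) → _)
      (unitaryPeriodDomain p q) := by
  have hA : Continuous fun Z : EuclideanSpace ℂ (Fin p) →L[ℂ] EuclideanSpace ℂ (Fin q) =>
      (ContinuousLinearMap.id ℂ (EuclideanSpace ℂ (Fin p))).prod Z := by
    have h : (fun Z : EuclideanSpace ℂ (Fin p) →L[ℂ] EuclideanSpace ℂ (Fin q) =>
        (ContinuousLinearMap.id ℂ (EuclideanSpace ℂ (Fin p))).prod Z) =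
        fun Z => ContinuousLinearMap.prodₗᵢ ℂ (ContinuousLinearMap.id ℂ _, Z) := rfl
    rw [h]
    exact (ContinuousLinearMap.prodₗᵢ ℂ).continuous.comp (continuous_const.prodMk continuous_id)
  have hB : Continuous fun Z : EuclideanSpace ℂ (Fin p) →L[ℂ] EuclideanSpace ℂ (Fin q) =>
      ContinuousLinearMap.fst ℂ (EuclideanSpace ℂ (Fin p)) (EuclideanSpace ℂ (Fin q)) -
        (ContinuousLinearMap.adjoint Z).comp (ContinuousLinearMap.snd ℂ _ _) :=
    continuous_const.sub ((ContinuousLinearMap.adjoint.continuous).clm_comp continuous_const)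
  exact hA.continuousOn.clm_comp (continuousOn_inverse_stdGramOp.clm_comp hB.continuousOn)

/-- **`Z ↦ J_Z` is continuous on the domain.** [cite: Deligne1982HodgeCycles, proof of Thm. 4.8, p. 49] -/
theorem continuousOn_stdJOp :
    ContinuousOn (stdJOp : (EuclideanSpace ℂ (Fin p) →L[ℂ] EuclideanSpace ℂ (Fin q)) → _)
      (unitaryPeriodDomain p q) :=
  ((continuousOn_stdProjOp.const_smul (2 : ℂ)).sub continuousOn_const).const_smul Complex.I

/-! ### `P_Z` is the `H₀`-orthogonal projection onto the graph of `Z` -/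

section Projection

variable {Z : EuclideanSpace ℂ (Fin p) →L[ℂ] EuclideanSpace ℂ (Fin q)}

/-- `P_Z x` lies on the graph of `Z`. [cite: GohbergLancasterRodman2005, §10.1 (10.1.9)] -/
theorem stdProjOp_mem_graphPlane (Z : EuclideanSpace ℂ (Fin p) →L[ℂ] EuclideanSpace ℂ (Fin q))
    (x : EuclideanSpace ℂ (Fin p) × EuclideanSpace ℂ (Fin q)) : stdProjOp Z x ∈ graphPlane Z := by
  rw [mem_graphPlane_iff, stdProjOp_apply]

/-- The `H₀`-orthogonal complement of the graph of `Z` contains `{(Z^* w, w)}`.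
[cite: GohbergLancasterRodman2005, §10.1] -/
theorem adjoint_pair_mem_orthogonalBilin (Z : EuclideanSpace ℂ (Fin p) →L[ℂ] EuclideanSpace ℂ (Fin q))
    (w : EuclideanSpace ℂ (Fin q)) :
    (ContinuousLinearMap.adjoint Z w, w) ∈
      Submodule.orthogonalBilin (stdHermitianSesqForm p q) (graphPlane Z) := by
  rw [Submodule.mem_orthogonalBilin_iff]
  intro n hn
  rw [mem_graphPlane_iff] at hn
  rw [stdHermitianSesqForm_apply, stdHermitianForm, hn, ContinuousLinearMap.adjoint_inner_right,
    sub_self]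

/-- For `‖Z‖ < 1`: `x - P_Z x = (Z^* w, w)` with `w = x₂ - Z v`, hence lies in the `H₀`-orthogonal
complement of the graph. [cite: GohbergLancasterRodman2005, §10.1] -/
theorem sub_stdProjOp_mem_orthogonalBilin (hZ : Z ∈ unitaryPeriodDomain p q)
    (x : EuclideanSpace ℂ (Fin p) × EuclideanSpace ℂ (Fin q)) :
    x - stdProjOp Z x ∈ Submodule.orthogonalBilin (stdHermitianSesqForm p q) (graphPlane Z) := by
  set v := Ring.inverse (stdGramOp Z) (x.1 - ContinuousLinearMap.adjoint Z x.2) with hv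
  have hG : stdGramOp Z v = x.1 - ContinuousLinearMap.adjoint Z x.2 := by
    have h := Ring.mul_inverse_cancel _ (isUnit_stdGramOp hZ)
    have h' := congrArg (fun T : EuclideanSpace ℂ (Fin p) →L[ℂ] EuclideanSpace ℂ (Fin p) =>
      T (x.1 - ContinuousLinearMap.adjoint Z x.2)) h
    simpa only [ContinuousLinearMap.mul_def, ContinuousLinearMap.comp_apply, one_apply_eq_self]
      using h'
  have h1 : x.1 - v = ContinuousLinearMap.adjoint Z (x.2 - Z v) := by
    have hG' : v - ContinuousLinearMap.adjoint Z (Z v) = x.1 - ContinuousLinearMap.adjoint Z x.2 := by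
      simpa [stdGramOp] using hG
    rw [map_sub]
    linear_combination (norm := skip) -hG'
    abel
  have hx : x - stdProjOp Z x = (ContinuousLinearMap.adjoint Z (x.2 - Z v), x.2 - Z v) := by
    rw [stdProjOp_apply, ← hv]
    ext1
    · simpa using h1
    · simp
  rw [hx]
  exact adjoint_pair_mem_orthogonalBilin Z _

variable (hZ : Z ∈ unitaryPeriodDomain p q)
  (h : IsCompl (graphPlane Z) (Submodule.orthogonalBilin (stdHermitianSesqForm p q) (graphPlane Z)))

include hZ in
/-- **`P_Z` is van Geemen's `x ↦ x₊`** for `W = graph Z`. [cite: vanGeemen1994HodgeAV, 5.5–5.6]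
[cite: GohbergLancasterRodman2005, §10.1] -/
theorem weilPlusPart_eq_stdProjOp (x : EuclideanSpace ℂ (Fin p) × EuclideanSpace ℂ (Fin q)) :
    weilPlusPart h x = stdProjOp Z x := by
  have hx : x = stdProjOp Z x + (x - stdProjOp Z x) := by abel
  conv_lhs => rw [hx]
  rw [map_add, weilPlusPart_eq_self h (stdProjOp_mem_graphPlane Z x),
    weilPlusPart_eq_zero h (sub_stdProjOp_mem_orthogonalBilin hZ x), add_zero]

include hZ in
/-- … and `x - P_Z x` is `x₋`. [cite: vanGeemen1994HodgeAV, 5.5–5.6] -/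
theorem weilMinusPart_eq_sub_stdProjOp (x : EuclideanSpace ℂ (Fin p) × EuclideanSpace ℂ (Fin q)) :
    weilMinusPart h x = x - stdProjOp Z x := by
  have hsum := weilPlusPart_add_weilMinusPart h x
  rw [weilPlusPart_eq_stdProjOp hZ h] at hsum
  linear_combination (norm := skip) hsum
  abel

include hZ in
/-- **`J_Z` is van Geemen's `J_{W_Z}`** (`i` on the graph of `Z`, `-i` on its `H₀`-orthogonal
complement). [cite: vanGeemen1994HodgeAV, 5.5] [cite: GohbergLancasterRodman2005, §10.1] -/
theorem stdJOp_eq_complexStructureOfPlane :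
    ((stdJOp Z : _ →L[ℂ] _) : _ →ₗ[ℂ] _) = complexStructureOfPlane (graphPlane Z) h := by
  refine LinearMap.ext fun x => ?_
  rw [ContinuousLinearMap.coe_coe, stdJOp_apply, complexStructureOfPlane_apply,
    weilPlusPart_eq_stdProjOp hZ h, weilMinusPart_eq_sub_stdProjOp hZ h, two_smul, smul_sub, smul_sub,
    smul_add]
  abel

end Projection

/-! ### The image of `Z ↦ J_Z` is `X⁺(H₀)`, which is therefore path connected -/

variable (p q)

/-- **`X⁺(H₀)` inside the bounded operators**: the complex structures of Weil type of the standard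
Hermitian space of signature `(p, q)`, as a subset of the normed algebra `End(ℂᵖ × ℂ^q)`.
[cite: Deligne1982HodgeCycles, proof of Thm. 4.8, p. 49] [cite: vanGeemen1994HodgeAV, 5.8–5.10] -/
def stdWeilDomain :
    Set ((EuclideanSpace ℂ (Fin p) × EuclideanSpace ℂ (Fin q)) →L[ℂ]
      (EuclideanSpace ℂ (Fin p) × EuclideanSpace ℂ (Fin q))) :=
  {J | IsWeilComplexStructure (stdHermitianSesqForm p q) (J : _ →ₗ[ℂ] _)}

variable {p q}

/-- Membership in `stdWeilDomain`. [cite: vanGeemen1994HodgeAV, 5.6] -/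
theorem mem_stdWeilDomain_iff
    {J : (EuclideanSpace ℂ (Fin p) × EuclideanSpace ℂ (Fin q)) →L[ℂ]
      (EuclideanSpace ℂ (Fin p) × EuclideanSpace ℂ (Fin q))} :
    J ∈ stdWeilDomain p q ↔ IsWeilComplexStructure (stdHermitianSesqForm p q) (J : _ →ₗ[ℂ] _) :=
  Iff.rfl

/-- `J_Z ∈ X⁺(H₀)` for `‖Z‖ < 1`. [cite: vanGeemen1994HodgeAV, 5.6] -/
theorem stdJOp_mem_stdWeilDomain {Z : EuclideanSpace ℂ (Fin p) →L[ℂ] EuclideanSpace ℂ (Fin q)}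
    (hZ : Z ∈ unitaryPeriodDomain p q) : stdJOp Z ∈ stdWeilDomain p q := by
  have hW : IsPolarizingPlane (stdHermitianSesqForm p q) (graphPlane Z) :=
    isPolarizingPlane_std_iff.2 ((isPositivePlane_graphPlane_iff Z).2 hZ)
  have h := isCompl_orthogonalBilin_of_isPosDefOn hW.1
  rw [mem_stdWeilDomain_iff, stdJOp_eq_complexStructureOfPlane hZ h]
  exact isWeilComplexStructure_complexStructureOfPlane h (isSymm_stdHermitianSesqForm p q) hW

/-- `complexStructureOfPlane` only depends on the plane. [folklore] -/
theorem complexStructureOfPlane_congr {V : Type*} [AddCommGroup V] [Module ℂ V]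
    {H : V →ₗ⋆[ℂ] V →ₗ[ℂ] ℂ} {W W' : Submodule ℂ V} (hWW' : W = W')
    (h : IsCompl W (Submodule.orthogonalBilin H W)) (h' : IsCompl W' (Submodule.orthogonalBilin H W')) :
    complexStructureOfPlane W h = complexStructureOfPlane W' h' := by
  subst hWW'
  rfl

/-- **The image of the ball under `Z ↦ J_Z` is exactly `X⁺(H₀)`.**
[cite: vanGeemen1994HodgeAV, 5.5–5.8] [cite: GohbergLancasterRodman2005, §10.1 Cor. 10.1.4] -/
theorem stdJOp_image : stdJOp '' unitaryPeriodDomain p q = stdWeilDomain p q := by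
  apply Set.Subset.antisymm
  · rintro J ⟨Z, hZ, rfl⟩
    exact stdJOp_mem_stdWeilDomain hZ
  · intro J hJ
    have hJ' : IsWeilComplexStructure (stdHermitianSesqForm p q)
        ((J : _ →L[ℂ] _) : (EuclideanSpace ℂ (Fin p) × EuclideanSpace ℂ (Fin q)) →ₗ[ℂ]
          (EuclideanSpace ℂ (Fin p) × EuclideanSpace ℂ (Fin q))) := hJ
    set Z := stdWeilComplexStructureEquiv p q ⟨_, hJ'⟩ with hZdef
    refine ⟨Z.1, Z.2, ?_⟩
    have hgraph : graphPlane Z.1 = Module.End.eigenspace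
        ((J : _ →L[ℂ] _) : (EuclideanSpace ℂ (Fin p) × EuclideanSpace ℂ (Fin q)) →ₗ[ℂ]
          (EuclideanSpace ℂ (Fin p) × EuclideanSpace ℂ (Fin q))) Complex.I :=
      graphPlane_stdWeilComplexStructureEquiv ⟨_, hJ'⟩
    have hW : IsPolarizingPlane (stdHermitianSesqForm p q) (graphPlane Z.1) :=
      isPolarizingPlane_std_iff.2 ((isPositivePlane_graphPlane_iff Z.1).2 Z.2)
    have h := isCompl_orthogonalBilin_of_isPosDefOn hW.1
    have h' := isCompl_orthogonalBilin_of_isPosDefOn hJ'.isPolarizingPlane_eigenspace.1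
    have hlin : ((stdJOp Z.1 : _ →L[ℂ] _) : _ →ₗ[ℂ] _) =
        ((J : _ →L[ℂ] _) : (EuclideanSpace ℂ (Fin p) × EuclideanSpace ℂ (Fin q)) →ₗ[ℂ]
          (EuclideanSpace ℂ (Fin p) × EuclideanSpace ℂ (Fin q))) := by
      rw [stdJOp_eq_complexStructureOfPlane Z.2 h, complexStructureOfPlane_congr hgraph h h',
        hJ'.complexStructureOfPlane_eigenspace h']
    exact ContinuousLinearMap.coe_injective hlin

/-- **Deligne: `X⁺` is connected** — the complex structures of Weil type of the standard Hermitian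
space of signature `(p, q)` form a PATH CONNECTED subset of `End(ℂᵖ × ℂ^q)` (continuous image of
the convex type AIII domain). [cite: Deligne1982HodgeCycles, proof of Thm. 4.8, p. 49]
[cite: vanGeemen1994HodgeAV, 5.8–5.10] [cite: CarlsonMullerStachPeters2017, Thm. 16.1.5 (type AIII)] -/
theorem isPathConnected_stdWeilDomain : IsPathConnected (stdWeilDomain p q) := by
  rw [← stdJOp_image]
  exact (isPathConnected_unitaryPeriodDomain p q).image' continuousOn_stdJOp

/-- … in particular connected … [cite: Deligne1982HodgeCycles, proof of Thm. 4.8, p. 49] -/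
theorem isConnected_stdWeilDomain : IsConnected (stdWeilDomain p q) :=
  isPathConnected_stdWeilDomain.isConnected

/-- … and non-empty. [cite: vanGeemen1994HodgeAV, 5.5] -/
theorem stdWeilDomain_nonempty : (stdWeilDomain p q).Nonempty :=
  isPathConnected_stdWeilDomain.nonempty

end Literature.AlgebraicGeometry.Motives

end
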